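import Summits.CriticalPhenomena.PercolationContinuityZ3.Theorems.PercNearOneGluingNoHeavyLowerTailCubicThreePointApexDecoupled
import Mathlib.Tactic.Ring
import Mathlib.Tactic.Linarith
import Mathlib.Tactic.Positivity
import HarnessLib

/-!
# `NoHeavyLowerTail` (stmt-CriticalPhenomena-4575) — the cubic SHADOW `SHAD = S₅ = t·Γ₂ + q·Γ₁ − e₃` of the regime pair:
# a regime-free, self-dual row, tight on stars AND triangles, squeezed between the regime pair and `H_{q+t}`

Support file (prover prim-ineq-gen-2 gen 10, new-inequality factory; `--supports stmt-CriticalPhenomena-4575`).  Pure algebra over a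
commutative ring / `ℝ`; no measure theory, no named facts, no sorries.  Vocabulary of `…CubicThreePointApexSplit` / `…ApexDecoupled`
(`CubicThreePointApex.{Gam, D1, D2, Gam1, Gam2, SBHK, SdBHK}`) and `…TerminalClosure` (`CubicThreePointTerminal.{AG, Ha, Hb, Hqt}`):
apex `a`, cells `(q,u₁,u₂,u₃,t) = (P(a|b|c), P(ab|c), P(ac|b), P(bc|a), P(abc))`, refinements `n = P(abc ∧ b ≁ c in ω ∖ a)`,
`n′ = P(a|b|c ∧ V(C_a) separates b from c in G)`; `Γ = AG − u₃(n+n′)`, `Γ₂ = AG − u₃n`, `Γ₁ = AG − u₃n′` (all three `≥ 0` are theorems),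
`D₂ = Ha − (t−q)u₃n`, `D₁ = Hb − (q−t)u₃n′`, REGIME PAIR `:= {t ≥ q ⇒ D₂ ≥ 0} ∧ {q ≥ t ⇒ D₁ ≥ 0}` (conjectured; implies SF3-Hmax).

## What is recorded here (memo run/shared/lean/prim/prim-ineq-gen-2/SHADOW-Shad.md)
1. `regimePair_iff_shadow`: the regime pair is ONE inequality `0 ≤ D₂ + (q − t)₊·Γ` (no hypothesis on `Γ`), because `D₂ − D₁ = (t−q)Γ`.
   Replacing `(q−t)₊` by any polynomial `f ≥ (q−t)₊` on the simplex gives a polynomial COROLLARY `0 ≤ D₂ + f·Γ` of the regime pair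
   (given `Γ ≥ 0`; `shadow_of_regimePair`).  The smallest linear `f` is `f = q`, the smallest quadratic one found is `f = q(1−t)`.
2. The CUBIC SHADOW  `S₅ := t·Γ₂ + q·Γ₁ − u₁u₂u₃` (Lean `Shad`; memo name SHAD)  satisfies (`ring` identities)
     `S₅ = D₂ + q·Γ = D₁ + t·Γ`  (`Shad_eq_D2_add`, `Shad_eq_D1_add`),    `S₅ = H_{q+t} − u₃·(t·n + q·n′)`  (`Shad_eq_Hqt_sub`),
   is SELF-DUAL under `q ↔ t, n ↔ n′` (`Shad_dual`) and symmetric under `u₁ ↔ u₂` (`Shad_swap`), and VANISHES IDENTICALLY on every star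
   (`Shad_star`) and every triangle (`Shad_triangle`) — it is tight on both identity families at once, like `Γ`.  Consequently
     REGIME PAIR ∧ `Γ ≥ 0`  ⟹  `S₅ ≥ 0`  ⟹  `H_{q+t} ≥ 0`     (`Shad_nonneg_of_regimePair`, `Hqt_nonneg_of_Shad`; cells `≥ 0`),
   so `S₅ ≥ 0` is a regime-free polynomial row lying between the (conjectured) regime pair and the (open) last cubic three-point row
   `H_{q+t} = (q+t)(qt − e₂) − e₃ ≥ 0`; the quartic shadow `S₅ − q·t·Γ = D₂ + q(1−t)Γ = D₁ + t(1−q)Γ` is sharper still (`shadow4_eq`,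
   `shadow4_nonneg_of_regimePair`).
3. STATUS (2026-08-20, this seat; NOT claimed as theorems): `S₅ ≥ 0` inherits every census of the regime pair (ttrl2 exhaustive n ≤ 8,
   skew censuses 0 / 6.5·10⁸ through n = 11) and is sharp (`min −D₂/(qΓ) = 0.993` over sampled graphs, so `f = q` cannot be lowered);
   it is violated (`−2.4·10⁻³`) at the 7-cell pseudo-law of HMAX-GEN7 (N1), so it is not a consequence of the known rows; and — the point of
   filing it — `S₅` is THREE-COPY COMB POSITIVE (all `4^m` tensor-Bernstein coefficients `≥ 0`) on every support with `≤ 5` vertices and every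
   apex triple (46.1 M fibres, 0 negative; lab/fib3.c), exactly like `H_{q+t}` (prim-cert-2 FINDING-COMB-POSITIVITY) and unlike the Hmax branches
   `Ha`, `Hb` (negative fibres from `K₄` on).  A three-copy switching certificate for `S₅` (lit-2's refined types `Tpa = n`, `Qsa = n′` suffice to
   state it) would prove `H_{q+t}` on every finite weighted graph.  The stronger cubic `S₇ := S₅ − u₃·n·n′` (`ShadX`, `ShadX_eq`) is also comb positive
   on `≤ 5` vertices and skew-census clean, but is NOT implied by the regime pair; `S₅ − 2u₃nn′` has negative fibres.
[cite: Gladkov2024StrongFKG, Cor. 4.2 (the quadratic form AG)]; [cite: VandenbergHaggstromKahn2005, Thm 1.4 (u₁u₂ ≥ qn)]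
-/

namespace Summit.CriticalPhenomena.PercolationContinuityZ3.Theorems

namespace CubicThreePointApex

open CubicThreePointTerminal CubicThreePointSharp

variable {R : Type*} [CommRing R]

/-! ### The cubic shadow `S₅` and its identities (any commutative ring) -/

/-- The cubic shadow of the regime pair: `S₅ = t·Γ₂ + q·Γ₁ − u₁u₂u₃`. [this work] -/
def Shad (q u₁ u₂ u₃ t n n' : R) : R :=
  t * Gam2 q u₁ u₂ u₃ t n + q * Gam1 q u₁ u₂ u₃ t n' - u₁ * u₂ * u₃

/-- `S₅ = D₂ + q·Γ`. [this work] -/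
theorem Shad_eq_D2_add (q u₁ u₂ u₃ t n n' : R) :
    Shad q u₁ u₂ u₃ t n n' = D2 q u₁ u₂ u₃ t n + q * Gam q u₁ u₂ u₃ t n n' := by
  simp only [Shad, Gam2, Gam1, D2, Gam, Ha, AG]; ring

/-- `S₅ = D₁ + t·Γ`. [this work] -/
theorem Shad_eq_D1_add (q u₁ u₂ u₃ t n n' : R) :
    Shad q u₁ u₂ u₃ t n n' = D1 q u₁ u₂ u₃ t n' + t * Gam q u₁ u₂ u₃ t n n' := by
  simp only [Shad, Gam2, Gam1, D1, Gam, Hb, AG]; ring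

/-- `S₅ = H_{q+t} − u₃·(t·n + q·n′)`. [this work] -/
theorem Shad_eq_Hqt_sub (q u₁ u₂ u₃ t n n' : R) :
    Shad q u₁ u₂ u₃ t n n' = Hqt q u₁ u₂ u₃ t - u₃ * (t * n + q * n') := by
  simp only [Shad, Gam2, Gam1, Hqt, AG]; ring

/-- `S₅ = (q+t)·Γ + u₃·(t·n′ + q·n) − u₁u₂u₃`. [this work] -/
theorem Shad_eq_Gam_add (q u₁ u₂ u₃ t n n' : R) :
    Shad q u₁ u₂ u₃ t n n' = (q + t) * Gam q u₁ u₂ u₃ t n n' + u₃ * (t * n' + q * n) - u₁ * u₂ * u₃ := by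
  simp only [Shad, Gam2, Gam1, Gam, AG]; ring

/-- `S₅ = (q+t)·Γ − u₃·(u₁u₂ − q·n − t·n′)`: the shadow is the regime pair's `max(q,t)·Γ ≥ u₃(u₁u₂ − qn − tn′)` (HMAX-GEN7 (I1))
with `max(q,t)` replaced by `q + t` — exactly as `H_{q+t}` relates to `Hmax`. [this work] -/
theorem Shad_eq_comb (q u₁ u₂ u₃ t n n' : R) :
    Shad q u₁ u₂ u₃ t n n' = (q + t) * Gam q u₁ u₂ u₃ t n n' - u₃ * (u₁ * u₂ - q * n - t * n') := by
  simp only [Shad, Gam2, Gam1, Gam, AG]; ring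

/-- SELF-DUALITY: `S₅` is invariant under the open/closed duality `q ↔ t`, `n ↔ n′`. [this work] -/
theorem Shad_dual (q u₁ u₂ u₃ t n n' : R) :
    Shad t u₁ u₂ u₃ q n' n = Shad q u₁ u₂ u₃ t n n' := by
  simp only [Shad, Gam2, Gam1, AG]; ring

/-- `S₅` is symmetric under `b ↔ c` (`u₁ ↔ u₂`; `n`, `n′` are `b,c`-symmetric). [this work] -/
theorem Shad_swap (q u₁ u₂ u₃ t n n' : R) :
    Shad q u₂ u₁ u₃ t n n' = Shad q u₁ u₂ u₃ t n n' := by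
  simp only [Shad, Gam2, Gam1, AG]; ring

/-! ### Tightness on BOTH identity families -/

/-- STAR law (hub with arms `α, β, γ` to `a, b, c`; apex `a`; `n = 0`, `n′ = α(1−β)(1−γ)`): `S₅ = 0` identically. [this work] -/
theorem Shad_star (α β γ : R) :
    Shad (1 - (α * β + α * γ + β * γ) + 2 * (α * β * γ)) (α * β * (1 - γ)) (α * γ * (1 - β)) (β * γ * (1 - α))
      (α * β * γ) 0 (α * (1 - β) * (1 - γ)) = 0 := by
  simp only [Shad, Gam2, Gam1, AG]; ring

/-- TRIANGLE law (`p_bc = x, p_ac = y, p_ab = z`; apex `a`; `n = yz(1−x)`, `n′ = 0`): `S₅ = 0` identically. [this work] -/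
theorem Shad_triangle (x y z : R) :
    Shad ((1 - x) * (1 - y) * (1 - z)) (z * (1 - x) * (1 - y)) (y * (1 - x) * (1 - z)) (x * (1 - y) * (1 - z))
      (x * y + x * z + y * z - 2 * (x * y * z)) (y * z * (1 - x)) 0 = 0 := by
  simp only [Shad, Gam2, Gam1, AG]; ring

/-! ### The stronger cubic `S₇ = S₅ − u₃·n·n′` (census row; NOT implied by the regime pair) -/

/-- `S₇ = S₅ − u₃·n·n′`. [this work] -/
def ShadX (q u₁ u₂ u₃ t n n' : R) : R := Shad q u₁ u₂ u₃ t n n' - u₃ * n * n'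

/-- `S₇ = H_{q+t} − u₃·((t+n′)(q+n) − q·t)`. [this work] -/
theorem ShadX_eq (q u₁ u₂ u₃ t n n' : R) :
    ShadX q u₁ u₂ u₃ t n n' = Hqt q u₁ u₂ u₃ t - u₃ * ((t + n') * (q + n) - q * t) := by
  simp only [ShadX, Shad, Gam2, Gam1, Hqt, AG]; ring

/-- `S₇` is self-dual as well. [this work] -/
theorem ShadX_dual (q u₁ u₂ u₃ t n n' : R) :
    ShadX t u₁ u₂ u₃ q n' n = ShadX q u₁ u₂ u₃ t n n' := by
  simp only [ShadX, Shad, Gam2, Gam1, AG]; ring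

/-! ### The quartic shadow `S₅ − q·t·Γ` -/

/-- `S₅ − q·t·Γ = D₂ + q(1−t)·Γ = D₁ + t(1−q)·Γ` (both forms). [this work] -/
theorem shadow4_eq (q u₁ u₂ u₃ t n n' : R) :
    Shad q u₁ u₂ u₃ t n n' - q * t * Gam q u₁ u₂ u₃ t n n' = D2 q u₁ u₂ u₃ t n + q * (1 - t) * Gam q u₁ u₂ u₃ t n n'
    ∧ Shad q u₁ u₂ u₃ t n n' - q * t * Gam q u₁ u₂ u₃ t n n' = D1 q u₁ u₂ u₃ t n' + t * (1 - q) * Gam q u₁ u₂ u₃ t n n' := by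
  constructor
  · rw [Shad_eq_D2_add]; ring
  · rw [Shad_eq_D1_add]; ring

/-! ### Real cells: the shadow picture -/

/-- **The regime pair is one inequality.**  `{q ≤ t ⇒ D₂ ≥ 0} ∧ {t ≤ q ⇒ D₁ ≥ 0}  ⟺  `0 ≤ D₂ + (q−t)₊·Γ`  (since `D₂ − D₁ = (t−q)Γ`;
no sign hypothesis on `Γ`). [this work] -/
theorem regimePair_iff_shadow (q u₁ u₂ u₃ t n n' : ℝ) :
    ((q ≤ t → 0 ≤ D2 q u₁ u₂ u₃ t n) ∧ (t ≤ q → 0 ≤ D1 q u₁ u₂ u₃ t n'))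
      ↔ 0 ≤ D2 q u₁ u₂ u₃ t n + max (q - t) 0 * Gam q u₁ u₂ u₃ t n n' := by
  have hd : D2 q u₁ u₂ u₃ t n - D1 q u₁ u₂ u₃ t n' = (t - q) * Gam q u₁ u₂ u₃ t n n' := D2_sub_D1 q u₁ u₂ u₃ t n n'
  constructor
  · rintro ⟨h2, h1⟩
    rcases le_total q t with hqt | htq
    · rw [max_eq_right (sub_nonpos.mpr hqt)]; linarith [h2 hqt]
    · rw [max_eq_left (sub_nonneg.mpr htq)]; nlinarith [h1 htq]
  · intro h
    refine ⟨fun hqt => ?_, fun htq => ?_⟩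
    · rw [max_eq_right (sub_nonpos.mpr hqt)] at h; linarith
    · rw [max_eq_left (sub_nonneg.mpr htq)] at h; nlinarith

/-- **Polynomial shadows.**  If the regime pair holds and `Γ ≥ 0`, then `0 ≤ D₂ + f·Γ` for every `f ≥ (q−t)₊`. [this work] -/
theorem shadow_of_regimePair {q u₁ u₂ u₃ t n n' f : ℝ} (hG : 0 ≤ Gam q u₁ u₂ u₃ t n n')
    (hR : (q ≤ t → 0 ≤ D2 q u₁ u₂ u₃ t n) ∧ (t ≤ q → 0 ≤ D1 q u₁ u₂ u₃ t n')) (hf : max (q - t) 0 ≤ f) :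
    0 ≤ D2 q u₁ u₂ u₃ t n + f * Gam q u₁ u₂ u₃ t n n' := by
  have h := (regimePair_iff_shadow q u₁ u₂ u₃ t n n').mp hR
  nlinarith [mul_le_mul_of_nonneg_right hf hG]

/-- **REGIME PAIR ∧ Γ ≥ 0 ⟹ S₅ ≥ 0** (for `q, t ≥ 0`; the cubic shadow, `f = q`). [this work] -/
theorem Shad_nonneg_of_regimePair {q u₁ u₂ u₃ t n n' : ℝ} (hq : 0 ≤ q) (ht : 0 ≤ t) (hG : 0 ≤ Gam q u₁ u₂ u₃ t n n')
    (hR : (q ≤ t → 0 ≤ D2 q u₁ u₂ u₃ t n) ∧ (t ≤ q → 0 ≤ D1 q u₁ u₂ u₃ t n')) :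
    0 ≤ Shad q u₁ u₂ u₃ t n n' := by
  rw [Shad_eq_D2_add]
  refine shadow_of_regimePair hG hR (max_le ?_ ?_) <;> linarith

/-- **REGIME PAIR ∧ Γ ≥ 0 ⟹ the quartic shadow `S₅ − qtΓ ≥ 0`** (for `0 ≤ q ≤ 1`, `0 ≤ t ≤ 1`; `f = q(1−t) ≥ (q−t)₊`). [this work] -/
theorem shadow4_nonneg_of_regimePair {q u₁ u₂ u₃ t n n' : ℝ} (hq : 0 ≤ q) (hq1 : q ≤ 1) (ht : 0 ≤ t) (ht1 : t ≤ 1)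
    (hG : 0 ≤ Gam q u₁ u₂ u₃ t n n')
    (hR : (q ≤ t → 0 ≤ D2 q u₁ u₂ u₃ t n) ∧ (t ≤ q → 0 ≤ D1 q u₁ u₂ u₃ t n')) :
    0 ≤ Shad q u₁ u₂ u₃ t n n' - q * t * Gam q u₁ u₂ u₃ t n n' := by
  rw [(shadow4_eq q u₁ u₂ u₃ t n n').1]
  refine shadow_of_regimePair hG hR (max_le ?_ ?_)
  · nlinarith [mul_nonneg ht (sub_nonneg.mpr hq1)]
  · nlinarith [mul_nonneg hq (sub_nonneg.mpr ht1)]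

/-- `S₅ ≤ H_{q+t}` for nonnegative `q, t, u₃, n, n′`. [this work] -/
theorem Shad_le_Hqt {q u₁ u₂ u₃ t n n' : ℝ} (hq : 0 ≤ q) (hu₃ : 0 ≤ u₃) (ht : 0 ≤ t) (hn : 0 ≤ n) (hn' : 0 ≤ n') :
    Shad q u₁ u₂ u₃ t n n' ≤ Hqt q u₁ u₂ u₃ t := by
  rw [Shad_eq_Hqt_sub]
  nlinarith [mul_nonneg hu₃ (add_nonneg (mul_nonneg ht hn) (mul_nonneg hq hn'))]

/-- **S₅ ≥ 0 ⟹ H_{q+t} ≥ 0** (nonnegative cells). [this work] -/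
theorem Hqt_nonneg_of_Shad {q u₁ u₂ u₃ t n n' : ℝ} (hq : 0 ≤ q) (hu₃ : 0 ≤ u₃) (ht : 0 ≤ t) (hn : 0 ≤ n) (hn' : 0 ≤ n')
    (hS : 0 ≤ Shad q u₁ u₂ u₃ t n n') : 0 ≤ Hqt q u₁ u₂ u₃ t :=
  le_trans hS (Shad_le_Hqt hq hu₃ ht hn hn')

/-- **S₅ ≥ 0 sharpens AG⁺ to tightness on stars and triangles:** on the simplex with nonnegative cells and `Γ ≥ 0`,
`S₅ ≥ 0 ⟹ u₃·((1−q)·n + (1−t)·n′) ≤ AG − e₃` (the row `R₁ = Γ − u₃(u₁u₂ − qn − tn′) ≥ 0`, between `S₅` and AG⁺). [this work] -/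
theorem agPlus_sharp_of_Shad {q u₁ u₂ u₃ t n n' : ℝ} (hσ : q + u₁ + u₂ + u₃ + t = 1) (hu₁ : 0 ≤ u₁) (hu₂ : 0 ≤ u₂)
    (hu₃ : 0 ≤ u₃) (hG : 0 ≤ Gam q u₁ u₂ u₃ t n n') (hS : 0 ≤ Shad q u₁ u₂ u₃ t n n') :
    u₃ * ((1 - q) * n + (1 - t) * n') ≤ AG q u₁ u₂ u₃ t - u₁ * u₂ * u₃ := by
  rw [Shad_eq_comb] at hS
  have hqt : q + t = 1 - (u₁ + u₂ + u₃) := by linarith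
  have hG' : Gam q u₁ u₂ u₃ t n n' = AG q u₁ u₂ u₃ t - u₃ * (n + n') := rfl
  nlinarith [mul_nonneg (add_nonneg (add_nonneg hu₁ hu₂) hu₃) hG]

/-- `S₇ ≤ S₅` for nonnegative `u₃, n, n′` (so `S₇ ≥ 0 ⟹ S₅ ≥ 0 ⟹ H_{q+t} ≥ 0`). [this work] -/
theorem ShadX_le_Shad {q u₁ u₂ u₃ t n n' : ℝ} (hu₃ : 0 ≤ u₃) (hn : 0 ≤ n) (hn' : 0 ≤ n') :
    ShadX q u₁ u₂ u₃ t n n' ≤ Shad q u₁ u₂ u₃ t n n' := by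
  simp only [ShadX]
  nlinarith [mul_nonneg (mul_nonneg hu₃ hn) hn']

/-- **REGIME PAIR ∧ Γ ≥ 0 ⟹ H_{q+t} ≥ 0** via the shadow (the known implication `Hmax ⇒ H_{q+t}`, re-derived without the `max`). [this work] -/
theorem Hqt_nonneg_of_regimePair {q u₁ u₂ u₃ t n n' : ℝ} (hq : 0 ≤ q) (hu₃ : 0 ≤ u₃) (ht : 0 ≤ t) (hn : 0 ≤ n) (hn' : 0 ≤ n')
    (hG : 0 ≤ Gam q u₁ u₂ u₃ t n n')
    (hR : (q ≤ t → 0 ≤ D2 q u₁ u₂ u₃ t n) ∧ (t ≤ q → 0 ≤ D1 q u₁ u₂ u₃ t n')) :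
    0 ≤ Hqt q u₁ u₂ u₃ t :=
  Hqt_nonneg_of_Shad hq hu₃ ht hn hn' (Shad_nonneg_of_regimePair hq ht hG hR)

/-- The 7-cell pseudo-law of HMAX-GEN7 (N1) (satisfies every known row, `t ≈ q`) has `S₅ < 0`: the shadow is NOT a consequence of the known rows.
Cells `(W,N′,U₁,U₂,U₃,N,M) = (2643,67,1528,1525,1526,126,2585)/10⁴`, `q = W + N′`, `t = N + M`. [this work] -/
theorem Shad_pseudolaw_neg :
    Shad ((2643 + 67 : ℚ) / 10000) (1528 / 10000) (1525 / 10000) (1526 / 10000) ((126 + 2585) / 10000) (126 / 10000) (67 / 10000) < 0 := by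
  norm_num [Shad, Gam2, Gam1, AG]

end CubicThreePointApex

end Summit.CriticalPhenomena.PercolationContinuityZ3.Theorems
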